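import Literature.LinearAlgebra.Matrix.LatimerMacDuffeeTranspose
import Mathlib.LinearAlgebra.Dimension.OrzechProperty
import Mathlib.Data.ZMod.QuotientRing
import HarnessLib

/-!
# KNIGHT–STASINSKI: ideals of degree one of `ℤ[θ] = ℤ[X]/(f)`, their `ℤ`-basis, and the matrices `C_f(a,z)`
# representing their classes under the Latimer–MacDuffee–Taussky correspondence

Topic `LinearAlgebra/Matrix`, namespace `Literature.LinearAlgebra.Matrix`; sixth file of the series
`LatimerMacDuffee.lean` / `…Ideal` / `…Correspondence` / `…Companion` / `…Transpose` (the module `ℤⁿ_A =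
QuotModule f A hA` of an integer matrix root `A` of the monic `f`, `θ` acting as `v ↦ A v`; the class map `Φ`,
`Φ [A] = [J]` whenever `ℤⁿ_A ≅ J`; `Φ [C_f] = Φ [C_fᵀ] = [(1)]`; `Φ [Aᵀ] = ` the dual class `[((a) : J)]`).  ONE
definition with body (`knightStasinskiMatrix`, the matrix `C_f(a,z)`), otherwise theorems; no instance, no
notation, no named fact (net Literature debt `0`).

## Source, VERBATIM

L. Knight, A. Stasinski, *Representatives of similarity classes of matrices over PIDs corresponding to ideal
classes*, Glasgow Math. J. 66 (2023) 88–103 [KnightStasinski2023] (= arXiv:2205.02094, held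
`paper:arxiv-2205.02094`, chunks p0003–p0004, p0009–p0010). §1: "every similarity class with characteristic
polynomial `f(x)` contains a representative of the form `C_f(a,z) = [[0,1,0,…,0], …, [u_{n-1}, u_{n-2}, …, u₁,
-f(z)a⁻¹], [a, 0, …, 0, z]]`, where `a, z ∈ ℤ` are such that `a` divides `f(z)` and the `uᵢ ∈ ℤ` are explicitly
determined by `f(x)` and `z` […] For the case of `n = 2`, `C_f(a,z) = [[u₁, -f(z)a⁻¹], [a, z]]` is a general
`2 × 2` matrix".  §2 Def. 2.1: "A proper ideal `𝔞` of `𝒪` is said to be of degree one (over `A`) if `A + 𝔞 = 𝒪`."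
Lemma 2.2: "Let `𝔞` be an ideal of `A[θ]` and `𝔟 = A ∩ 𝔞`. Suppose that there exists a `z ∈ A` such that
`θ - z ∈ 𝔞`. Then the embedding `A → A[θ]` induces an isomorphism `A/𝔟 → A[θ]/(θ - z, 𝔟)` and `𝔞 = (θ - z, 𝔟)`."
Lemma 2.3: "`𝔞` is of degree one if and only if there exists a `z ∈ A` such that `𝔞 = (θ - z, 𝔟)`."  §4
Prop. 4.2: "Assume that `𝔞` is an ideal of `A[θ]` of degree one and let `a` be a generator of `A ∩ 𝔞`. Then there
exists a `z ∈ A` such that `f(z) ≡ 0 (mod a)` and `κ = κ(a,z)` is an ideal matrix for `𝔞`" (with Lemma 3.4: the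
entries of `κ·(1, θ, …, θⁿ⁻¹)ᵀ = (a, θ - z, θ² - z², …)` form an `A`-basis of `𝔞`).  §5 Lemma 5.1 (the matrix
`C_f(a,z)`, "where `uᵢ = -(zⁱ + k_{n-1}zⁱ⁻¹ + k_{n-2}zⁱ⁻² + ⋯ + k_{n-i+1}z + k_{n-i})`") and **Thm. 5.2**: "Let `𝔞` be an
ideal of `A[θ]` of degree one. The similarity class in `Mₙ(A)` that corresponds to the ideal class of `𝔞` under
the Latimer–MacDuffee correspondence contains a matrix of the form `C_f(a,z)`, where `a, z ∈ A` and
`f(z) ≡ 0 (mod a)`. In particular, if `A[θ] = B` is the maximal order, then every similarity class in `Mₙ(A)`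
contains a matrix of this form."  (The last sentence rests on LENSTRA's theorem, Thm. 2.7 / Cor. 2.8 — every ideal
class of the maximal order contains an ideal of degree one — and is NOT formalised here.)

Also: H. Endo, K. Iwaki, A. Pajitnov, arXiv:2604.01045 [EndoIwakiPajitnov2026], §3 Cor. 3.12 (chunk p0007):
"`{p, θ - b, θ(θ - b), …, θⁿ⁻²(θ - b)}` is a `ℤ`-basis of `(p, θ - b)`" (proof by «the Taylor expansion of `θʲ` at
`x = b`», the route taken in §2 below).

CONVENTIONS.  Here `A = ℤ`, `𝒪 = ℤ[θ] = AdjoinRoot f`; «`𝔞` of degree one» is rendered as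
`Function.Surjective (algebraMap ℤ (ℤ[θ] ⧸ 𝔞))` (`ℤ + 𝔞 = ℤ[θ]`; no properness is imposed), `A ∩ 𝔞` as
`𝔞.comap (algebraMap ℤ ℤ[θ])`.  The printed correspondence attaches to a matrix `α` the ideal spanned by an
eigenvector `α v = θ v` (KNIGHT–STASINSKI Thm. 3.2), i.e. `θ` acts through ROWS; the tree's `Φ` uses columns, so
«the class of `𝔞` contains `C_f(a,z)`» is the tree's `ℤⁿ_{C_f(a,z)ᵀ} ≅ 𝔞`, equivalently (by `LatimerMacDuffeeTranspose`)
`ℤⁿ_{C_f(a,z)} ≅ ((a) : 𝔞)`.  This generalises to every degree the cubic dictionary `X_{c,d,n} ↦ [⟨Θₙ - c, d⟩]`,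
`d ∣ fₙ(c)`, of `Literature/Topology/FourManifolds/CappellShanesonIdealClasses.lean` (KIM–YAMADA Prop. 2.14).

## What is formalised

`f ∈ ℤ[X]` monic (`[Fact f.Monic]`, `hdeg : f.natDegree = n`), `θ = AdjoinRoot.root f`; `[IsDomain (AdjoinRoot f)]`
(irreducibility) from §2's basis on.

* §1 (any `f`) **`surjective_algebraMap_quotient_iff_exists_root_sub_mem`** (Def. 2.1 / Lemma 2.3: `ℤ + 𝔞 = ℤ[θ] ⟺
  ∃ z, θ - z ∈ 𝔞`), **`eq_span_root_sub_sup_map_comap`** (Lemma 2.2: `θ - z ∈ 𝔞 ⟹ 𝔞 = (θ - z) + (ℤ ∩ 𝔞)ℤ[θ]`),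
  `eq_span_pair_of_root_sub_mem` / **`exists_eq_span_pair_of_surjective`** (`𝔞 = (θ - z, a)`, `aℤ = ℤ ∩ 𝔞`),
  `intCast_eval_mem_of_root_sub_mem`, `dvd_eval_of_root_sub_mem` (`f(z) ∈ 𝔞`, `a ∣ f(z)`).
* §2 **`span_pair_restrictScalars_eq_span`** (Prop. 4.2 / EIP Cor. 3.12: for `f(z) = am`, `(θ - z, a)` is the
  `ℤ`-span of `θ - z, θ(θ - z), …, θⁿ⁻²(θ - z), a` — TAYLOR expansion at `z`), **`exists_basis_span_pair`** (they form
  a `ℤ`-basis, `a ≠ 0`, `f` irreducible).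
* §3 `knightStasinskiMatrix n f a z` (= `C_f(a,z)`, with `u_{n-1-j} = -(f /ₘ (x - z))ⱼ` and `-f(z)a⁻¹ = -(f(z)/a)`),
  `knightStasinskiMatrix_two`, **`root_mul_eq_sum_knightStasinskiMatrix`** (`C_f(a,z)ᵀ` is the matrix of `θ` on that
  basis), `aeval_transpose_knightStasinskiMatrix_eq_zero` / `aeval_knightStasinskiMatrix_eq_zero` (`f(C) = 0`),
  `charpoly_knightStasinskiMatrix` (`χ_C = f`), **`QuotModule.nonempty_linearEquiv_transpose_knightStasinskiMatrix`**
  (THM. 5.2: `ℤⁿ_{C_f(a,z)ᵀ} ≅ (θ - z, a)`), `QuotModule.nonempty_linearEquiv_knightStasinskiMatrix_colon`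
  (`ℤⁿ_{C_f(a,z)} ≅ ((a) : (θ - z, a))`), `apply_transpose_knightStasinskiMatrix_eq` (`Φ [C_f(a,z)ᵀ] = [(θ - z, a)]`),
  **`exists_conj_transpose_knightStasinskiMatrix`** (THM. 5.2 for classes: `ℤⁿ_A ≅ J`, `(x)J = (y)𝔞` with `𝔞 ≠ 0` of
  degree one ⟹ `𝔞 = (θ - z, a)`, `0 ≠ a ∣ f(z)`, and `A ∼ C_f(a,z)ᵀ` over `GLₙ(ℤ)`).
* §4 (rider) `comap_span_pair_eq_span` (`ℤ ∩ (θ - z, a) = (a)` when `a ∣ f(z)`), `surjective_algebraMap_quotient_span_pair`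
  (`(θ - z, a)` is of degree one), **`nonempty_quotient_span_ringEquiv_quotient_span_pair`** (Lemma 2.2's isomorphism
  `ℤ/(a) ≅ ℤ[θ]/(θ - z, a)`), `natCard_quotient_span_pair` (`[ℤ[θ] : (θ - z, a)] = |a|`),
  **`exists_conj_knightStasinskiMatrix_iff`** (`C_f(a,z) ∼ C_f(a′,z′) ⟺ (θ - z, a) ≈ (θ - z′, a′)`).
-/

open Polynomial
open scoped Matrix

noncomputable section

namespace Literature.LinearAlgebra.Matrix

variable {n : ℕ}

/-! ### §1 Ideals of degree one: `ℤ + 𝔞 = ℤ[θ] ⟺ θ - z ∈ 𝔞 ⟺ 𝔞 = (θ - z, a)` -/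

section DegreeOne

variable {f : ℤ[X]}

/-- `p(θ) - p(z) ∈ (θ - z)`: every element of `ℤ[θ]` is congruent to an integer modulo `θ - z`. [folklore] -/
private theorem mk_sub_intCast_eval_mem_span (p : ℤ[X]) (z : ℤ) :
    AdjoinRoot.mk f p - ((p.eval z : ℤ) : AdjoinRoot f) ∈
      Ideal.span {AdjoinRoot.root f - (z : AdjoinRoot f)} := by
  rw [Ideal.mem_span_singleton]
  have h := sub_dvd_eval_sub (AdjoinRoot.root f) (z : AdjoinRoot f) (p.map (algebraMap ℤ (AdjoinRoot f)))
  rwa [eval_map, eval_map, ← aeval_def, ← aeval_def, AdjoinRoot.aeval_eq, ← eq_intCast (algebraMap ℤ (AdjoinRoot f)) z,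
    aeval_algebraMap_apply_eq_algebraMap_eval, eq_intCast] at h

/-- **KNIGHT–STASINSKI, Def. 2.1 / Lemma 2.3: an ideal `𝔞` of `ℤ[θ] = ℤ[X]/(f)` is «of degree one» — `ℤ + 𝔞 =
ℤ[θ]`, i.e. `ℤ → ℤ[θ]/𝔞` is onto — iff `θ - z ∈ 𝔞` for some `z ∈ ℤ`** (`⟹`: `θ ≡ z`; `⟸`: `g(θ) ≡ g(z)` for every
`g ∈ ℤ[x]`). (Any `f`; the notion generalises «prime ideal of degree one».) [cite: KnightStasinski2023, §2 Def. 2.1,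
Lemma 2.2 and Lemma 2.3, pp. 90–91] -/
theorem surjective_algebraMap_quotient_iff_exists_root_sub_mem (𝔞 : Ideal (AdjoinRoot f)) :
    Function.Surjective (algebraMap ℤ (AdjoinRoot f ⧸ 𝔞)) ↔
      ∃ z : ℤ, AdjoinRoot.root f - (z : AdjoinRoot f) ∈ 𝔞 := by
  have hmap : ∀ z : ℤ, algebraMap ℤ (AdjoinRoot f ⧸ 𝔞) z = Ideal.Quotient.mk 𝔞 (z : AdjoinRoot f) := fun z ↦ by
    rw [eq_intCast, map_intCast]
  constructor
  · intro h
    obtain ⟨z, hz⟩ := h (Ideal.Quotient.mk 𝔞 (AdjoinRoot.root f))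
    refine ⟨z, ?_⟩
    rw [← Ideal.Quotient.eq, ← hmap, hz]
  · rintro ⟨z, hz⟩ x
    obtain ⟨s, rfl⟩ := Ideal.Quotient.mk_surjective x
    obtain ⟨p, rfl⟩ := AdjoinRoot.mk_surjective s
    refine ⟨p.eval z, ?_⟩
    rw [hmap, eq_comm, Ideal.Quotient.eq]
    exact (Ideal.span_singleton_le_iff_mem 𝔞).2 hz (mk_sub_intCast_eval_mem_span p z)

/-- **KNIGHT–STASINSKI, Lemma 2.2: if `θ - z ∈ 𝔞` then `𝔞 = (θ - z, 𝔟)` with `𝔟 = ℤ ∩ 𝔞`** (the extension of the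
contraction): `g(θ) = (g(θ) - g(z)) + g(z)` with `g(θ) - g(z) ∈ (θ - z)` and, for `g(θ) ∈ 𝔞`, `g(z) ∈ ℤ ∩ 𝔞`.
[cite: KnightStasinski2023, §2 Lemma 2.2, p. 90] -/
theorem eq_span_root_sub_sup_map_comap {𝔞 : Ideal (AdjoinRoot f)} {z : ℤ}
    (hz : AdjoinRoot.root f - (z : AdjoinRoot f) ∈ 𝔞) :
    𝔞 = Ideal.span {AdjoinRoot.root f - (z : AdjoinRoot f)} ⊔
      (𝔞.comap (algebraMap ℤ (AdjoinRoot f))).map (algebraMap ℤ (AdjoinRoot f)) := by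
  apply le_antisymm
  · intro s hs
    obtain ⟨p, rfl⟩ := AdjoinRoot.mk_surjective s
    have h1 := mk_sub_intCast_eval_mem_span (f := f) p z
    have h2 : ((p.eval z : ℤ) : AdjoinRoot f) ∈ (𝔞.comap (algebraMap ℤ (AdjoinRoot f))).map
        (algebraMap ℤ (AdjoinRoot f)) := by
      rw [← eq_intCast (algebraMap ℤ (AdjoinRoot f))]
      refine Ideal.mem_map_of_mem _ (Ideal.mem_comap.2 ?_)
      rw [eq_intCast]
      have h3 := 𝔞.sub_mem hs ((Ideal.span_singleton_le_iff_mem 𝔞).2 hz h1)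
      rwa [sub_sub_cancel] at h3
    rw [← sub_add_cancel (AdjoinRoot.mk f p) ((p.eval z : ℤ) : AdjoinRoot f)]
    exact Submodule.add_mem_sup h1 h2
  · exact sup_le ((Ideal.span_singleton_le_iff_mem 𝔞).2 hz) Ideal.map_comap_le

/-- **`𝔞 = (θ - z, a)` when `θ - z ∈ 𝔞` and `ℤ ∩ 𝔞 = aℤ`** (`ℤ` is principal, so every ideal of degree one of
`ℤ[θ]` has this form — KNIGHT–STASINSKI's Lemma 2.3 «`𝔞` is of degree one if and only if there exists a `z ∈ A`
such that `𝔞 = (θ - z, 𝔟)`»). [cite: KnightStasinski2023, §2 Lemma 2.2 and Lemma 2.3, pp. 90–91] -/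
theorem eq_span_pair_of_root_sub_mem {𝔞 : Ideal (AdjoinRoot f)} {z a : ℤ}
    (hz : AdjoinRoot.root f - (z : AdjoinRoot f) ∈ 𝔞) (ha : 𝔞.comap (algebraMap ℤ (AdjoinRoot f)) = Ideal.span {a}) :
    𝔞 = Ideal.span {AdjoinRoot.root f - (z : AdjoinRoot f), (a : AdjoinRoot f)} := by
  rw [eq_span_root_sub_sup_map_comap hz, ha, Ideal.map_span, Set.image_singleton, eq_intCast, Ideal.span_insert]

/-- **Every ideal of degree one of `ℤ[θ]` is `(θ - z, a)` for integers `z`, `a`** (KNIGHT–STASINSKI Lemma 2.3 over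
the principal ideal domain `ℤ`). [cite: KnightStasinski2023, §2 Lemma 2.3, p. 91] -/
theorem exists_eq_span_pair_of_surjective {𝔞 : Ideal (AdjoinRoot f)}
    (h : Function.Surjective (algebraMap ℤ (AdjoinRoot f ⧸ 𝔞))) :
    ∃ z a : ℤ, AdjoinRoot.root f - (z : AdjoinRoot f) ∈ 𝔞 ∧ 𝔞.comap (algebraMap ℤ (AdjoinRoot f)) = Ideal.span {a} ∧
      𝔞 = Ideal.span {AdjoinRoot.root f - (z : AdjoinRoot f), (a : AdjoinRoot f)} := by
  obtain ⟨z, hz⟩ := (surjective_algebraMap_quotient_iff_exists_root_sub_mem 𝔞).1 h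
  obtain ⟨a, ha⟩ := Submodule.IsPrincipal.principal (𝔞.comap (algebraMap ℤ (AdjoinRoot f)))
  exact ⟨z, a, hz, ha, eq_span_pair_of_root_sub_mem hz ha⟩

/-- **`f(z) ∈ 𝔞` when `θ - z ∈ 𝔞`** («`θ ≡ z (mod 𝔞)`, so `f(z) ≡ f(θ) ≡ 0`»); hence `a ∣ f(z)` when `ℤ ∩ 𝔞 = aℤ`.
[cite: KnightStasinski2023, §4 Prop. 4.2 (proof), p. 97] -/
theorem intCast_eval_mem_of_root_sub_mem {𝔞 : Ideal (AdjoinRoot f)} {z : ℤ}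
    (hz : AdjoinRoot.root f - (z : AdjoinRoot f) ∈ 𝔞) : ((f.eval z : ℤ) : AdjoinRoot f) ∈ 𝔞 := by
  have h := mk_sub_intCast_eval_mem_span (f := f) f z
  rw [AdjoinRoot.mk_self, zero_sub, Ideal.neg_mem_iff] at h
  exact (Ideal.span_singleton_le_iff_mem 𝔞).2 hz h

/-- `a ∣ f(z)` when `θ - z ∈ 𝔞` and `ℤ ∩ 𝔞 = aℤ`. [cite: KnightStasinski2023, §4 Prop. 4.2, p. 97] -/
theorem dvd_eval_of_root_sub_mem {𝔞 : Ideal (AdjoinRoot f)} {z a : ℤ}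
    (hz : AdjoinRoot.root f - (z : AdjoinRoot f) ∈ 𝔞) (ha : 𝔞.comap (algebraMap ℤ (AdjoinRoot f)) = Ideal.span {a}) :
    a ∣ f.eval z := by
  rw [← Ideal.mem_span_singleton, ← ha, Ideal.mem_comap, eq_intCast]
  exact intCast_eval_mem_of_root_sub_mem hz

end DegreeOne

/-! ### §2 The `ℤ`-basis `θ - z, θ(θ - z), …, θⁿ⁻²(θ - z), a` of `(θ - z, a)` when `a ∣ f(z)` -/

section Basis

variable {f : ℤ[X]} [Fact f.Monic]

omit [Fact f.Monic] in
/-- TAYLOR at `z`: `θⁱ - zⁱ ∈ ℤ(θ - z) + ℤθ(θ - z) + ⋯` for `i + 1 ≤ n` (`θⁱ⁺¹ - zⁱ⁺¹ = θⁱ(θ - z) + z(θⁱ - zⁱ)`).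
[folklore] -/
private theorem root_pow_sub_pow_mem_span (z a : ℤ) {i : ℕ} (hi : i + 1 ≤ n) :
    AdjoinRoot.root f ^ i - ((z : AdjoinRoot f)) ^ i ∈
      Submodule.span ℤ (Set.range fun j : Fin n ↦
        if (j : ℕ) + 1 = n then (a : AdjoinRoot f)
        else AdjoinRoot.root f ^ (j : ℕ) * (AdjoinRoot.root f - (z : AdjoinRoot f))) := by
  induction i with
  | zero => rw [pow_zero, pow_zero, sub_self]; exact Submodule.zero_mem _
  | succ i ih =>
    have h : AdjoinRoot.root f ^ (i + 1) - (z : AdjoinRoot f) ^ (i + 1) =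
        AdjoinRoot.root f ^ i * (AdjoinRoot.root f - (z : AdjoinRoot f)) +
          z • (AdjoinRoot.root f ^ i - (z : AdjoinRoot f) ^ i) := by
      rw [zsmul_eq_mul]
      ring
    rw [h]
    exact Submodule.add_mem _ (Submodule.subset_span ⟨⟨i, by omega⟩, by simp [show ¬(i + 1 = n) by omega]⟩)
      (Submodule.smul_mem _ _ (ih (by omega)))

omit [Fact f.Monic] in
/-- TAYLOR at `z` for a polynomial of degree `< n`: `g(θ) - g(z)` lies in the `ℤ`-span. [folklore] -/
private theorem aeval_sub_eval_mem_span (z a : ℤ) {g : ℤ[X]} (hg : g.natDegree < n) :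
    aeval (AdjoinRoot.root f) g - ((g.eval z : ℤ) : AdjoinRoot f) ∈
      Submodule.span ℤ (Set.range fun j : Fin n ↦
        if (j : ℕ) + 1 = n then (a : AdjoinRoot f)
        else AdjoinRoot.root f ^ (j : ℕ) * (AdjoinRoot.root f - (z : AdjoinRoot f))) := by
  have h : aeval (AdjoinRoot.root f) g - ((g.eval z : ℤ) : AdjoinRoot f) =
      ∑ i ∈ Finset.range n, g.coeff i • (AdjoinRoot.root f ^ i - (z : AdjoinRoot f) ^ i) := by
    conv_lhs => rw [g.as_sum_range' n hg]
    simp only [map_sum, aeval_monomial, eval_finsetSum, eval_monomial, Int.cast_sum, Int.cast_mul, Int.cast_pow,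
      eq_intCast, ← Finset.sum_sub_distrib, zsmul_eq_mul, mul_sub]
  rw [h]
  exact Submodule.sum_mem _ fun i hi ↦
    Submodule.smul_mem _ _ (root_pow_sub_pow_mem_span z a (by have := Finset.mem_range.1 hi; omega))

/-- `θⁿ⁻¹(θ - z) ≡ -f(z) = -ma` modulo the `ℤ`-span, hence lies in it (the last step of the basis: «`(θ - b)θⁿ⁻¹`
is an element … since `deg(q - θⁿ⁻¹) ≤ n - 2` and `p ∣ r_k`»). [folklore] -/
private theorem root_pow_mul_root_sub_mem_span (hdeg : f.natDegree = n) (hn : n ≠ 0) {z a m : ℤ}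
    (hm : f.eval z = a * m) :
    AdjoinRoot.root f ^ (n - 1) * (AdjoinRoot.root f - (z : AdjoinRoot f)) ∈
      Submodule.span ℤ (Set.range fun j : Fin n ↦
        if (j : ℕ) + 1 = n then (a : AdjoinRoot f)
        else AdjoinRoot.root f ^ (j : ℕ) * (AdjoinRoot.root f - (z : AdjoinRoot f))) := by
  have hf : f.Monic := Fact.out
  -- `g = f - Xⁿ` has degree `< n` and `θⁿ = -g(θ)`
  have hg : (f - X ^ n).natDegree < n := by
    rcases eq_or_ne (f - X ^ n) 0 with h0 | h0
    · rw [h0, natDegree_zero]; exact Nat.pos_of_ne_zero hn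
    · refine (natDegree_lt_iff_degree_lt h0).2 ?_
      have h1 : f.degree = (X ^ n : ℤ[X]).degree := by rw [degree_X_pow, degree_eq_natDegree hf.ne_zero, hdeg]
      have h2 := degree_sub_lt h1 hf.ne_zero (by rw [hf.leadingCoeff, leadingCoeff_X_pow])
      rwa [degree_eq_natDegree hf.ne_zero, hdeg] at h2
  have hθn : AdjoinRoot.root f ^ n = -aeval (AdjoinRoot.root f) (f - X ^ n) := by
    rw [map_sub, map_pow, aeval_X, AdjoinRoot.aeval_eq, AdjoinRoot.mk_self, zero_sub, neg_neg]
  have hfz : (f - X ^ n).eval z = a * m - z ^ n := by rw [eval_sub, eval_pow, eval_X, hm]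
  -- the decomposition
  have key : AdjoinRoot.root f ^ (n - 1) * (AdjoinRoot.root f - (z : AdjoinRoot f)) =
      -(aeval (AdjoinRoot.root f) (f - X ^ n) - (((f - X ^ n).eval z : ℤ) : AdjoinRoot f))
        - z • (AdjoinRoot.root f ^ (n - 1) - (z : AdjoinRoot f) ^ (n - 1))
        + (-m) • (a : AdjoinRoot f) := by
    obtain ⟨k, rfl⟩ : ∃ k, n = k + 1 := ⟨n - 1, by omega⟩
    rw [hfz, Nat.add_sub_cancel, zsmul_eq_mul, zsmul_eq_mul]
    have h1 : AdjoinRoot.root f ^ k * (AdjoinRoot.root f - (z : AdjoinRoot f)) =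
        AdjoinRoot.root f ^ (k + 1) - z * AdjoinRoot.root f ^ k := by ring
    rw [h1, hθn]
    push_cast
    ring
  rw [key]
  refine Submodule.add_mem _ (Submodule.sub_mem _ (Submodule.neg_mem _ (aeval_sub_eval_mem_span z a hg))
    (Submodule.smul_mem _ _ (root_pow_sub_pow_mem_span z a (by omega)))) (Submodule.smul_mem _ _ ?_)
  exact Submodule.subset_span ⟨⟨n - 1, by omega⟩, by simp [show n - 1 + 1 = n by omega]⟩

/-- `θʲ(θ - z)` lies in the `ℤ`-span for EVERY `j ≤ n - 1` (`j < n - 1`: a generator; `j = n - 1`: the previous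
lemma). [folklore] -/
private theorem root_pow_mul_root_sub_mem_span' (hdeg : f.natDegree = n) (hn : n ≠ 0) {z a m : ℤ}
    (hm : f.eval z = a * m) {j : ℕ} (hj : j + 1 ≤ n) :
    AdjoinRoot.root f ^ j * (AdjoinRoot.root f - (z : AdjoinRoot f)) ∈
      Submodule.span ℤ (Set.range fun j : Fin n ↦
        if (j : ℕ) + 1 = n then (a : AdjoinRoot f)
        else AdjoinRoot.root f ^ (j : ℕ) * (AdjoinRoot.root f - (z : AdjoinRoot f))) := by
  rcases eq_or_ne (j + 1) n with h | h
  · have hj' : j = n - 1 := by omega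
    subst hj'
    exact root_pow_mul_root_sub_mem_span hdeg hn hm
  · exact Submodule.subset_span ⟨⟨j, by omega⟩, by simp [h]⟩

/-- **KNIGHT–STASINSKI Prop. 4.2 / ENDO–IWAKI–PAJITNOV Cor. 3.12, the `ℤ`-module `(θ - z, a)`**: if `a ∣ f(z)`,
say `f(z) = am`, then the ideal `(θ - z, a)` of `ℤ[θ] = ℤ[X]/(f)` (`f` monic of degree `n`) is, as a `ℤ`-module,
spanned by `θ - z, θ(θ - z), …, θⁿ⁻²(θ - z), a` («`{p, θ - b, θ(θ - b), …, θⁿ⁻²(θ - b)}` is a `ℤ`-basis of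
`(p, θ - b)`»; KNIGHT–STASINSKI: the rows of the ideal matrix `κ(a,z)` applied to `1, θ, …, θⁿ⁻¹`). Proof: the span
is an ideal — `θ · θⁿ⁻²(θ - z) = θⁿ⁻¹(θ - z) ≡ -f(z) = -ma` by TAYLOR expansion at `z`, `θ · a = a(θ - z) + za` — which
contains the two generators. [cite: KnightStasinski2023, §4 Prop. 4.2 with Lemma 3.4, pp. 96–97]
[cite: EndoIwakiPajitnov2026, §3 Cor. 3.12] -/
theorem span_pair_restrictScalars_eq_span (hdeg : f.natDegree = n) {z a m : ℤ} (hm : f.eval z = a * m) :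
    (Ideal.span {AdjoinRoot.root f - (z : AdjoinRoot f), (a : AdjoinRoot f)}).restrictScalars ℤ =
      Submodule.span ℤ (Set.range fun j : Fin n ↦
        if (j : ℕ) + 1 = n then (a : AdjoinRoot f)
        else AdjoinRoot.root f ^ (j : ℕ) * (AdjoinRoot.root f - (z : AdjoinRoot f))) := by
  have hf : f.Monic := Fact.out
  set L := Submodule.span ℤ (Set.range fun j : Fin n ↦
        if (j : ℕ) + 1 = n then (a : AdjoinRoot f)
        else AdjoinRoot.root f ^ (j : ℕ) * (AdjoinRoot.root f - (z : AdjoinRoot f))) with hL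
  apply le_antisymm
  · -- `(θ - z, a) ⊆ L`: `L` is an ideal containing the generators
    rcases eq_or_ne n 0 with hn | hn
    · -- degenerate `n = 0`: `ℤ[θ] = 0`
      subst hn
      have h1 : f = 1 := Polynomial.eq_one_of_monic_natDegree_zero hf hdeg
      have hS : Subsingleton (AdjoinRoot f) := by
        refine subsingleton_of_zero_eq_one ?_
        have h2 : (AdjoinRoot.mk f) (1 : ℤ[X]) = 0 := by
          rw [← h1]
          exact AdjoinRoot.mk_self
        rw [map_one] at h2
        exact h2.symm
      intro x _
      rw [Subsingleton.elim x 0]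
      exact Submodule.zero_mem _
    have hθ : ∀ x ∈ L, AdjoinRoot.root f * x ∈ L := by
      intro x hx
      refine Submodule.span_induction (p := fun x _ ↦ AdjoinRoot.root f * x ∈ L) ?_ ?_ ?_ ?_ hx
      · rintro _ ⟨j, rfl⟩
        by_cases hj : (j : ℕ) + 1 = n
        · simp only [if_pos hj]
          have h : AdjoinRoot.root f * (a : AdjoinRoot f) =
              a • (AdjoinRoot.root f ^ 0 * (AdjoinRoot.root f - (z : AdjoinRoot f))) + z • (a : AdjoinRoot f) := by
            rw [zsmul_eq_mul, zsmul_eq_mul]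
            ring
          rw [h]
          exact Submodule.add_mem _ (Submodule.smul_mem _ _ (root_pow_mul_root_sub_mem_span' hdeg hn hm (by omega)))
            (Submodule.smul_mem _ _ (Submodule.subset_span ⟨j, by simp [hj]⟩))
        · simp only [if_neg hj]
          rw [← mul_assoc, ← pow_succ']
          exact root_pow_mul_root_sub_mem_span' hdeg hn hm (by omega)
      · rw [mul_zero]; exact Submodule.zero_mem _
      · intro x y _ _ hx hy
        rw [mul_add]
        exact Submodule.add_mem _ hx hy
      · intro c x _ hx
        rw [mul_smul_comm]
        exact Submodule.smul_mem _ _ hx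
    have hS : ∀ (s x : AdjoinRoot f), x ∈ L → s * x ∈ L := by
      intro s
      obtain ⟨p, rfl⟩ := AdjoinRoot.mk_surjective s
      induction p using Polynomial.induction_on with
      | C c =>
        intro x hx
        rw [AdjoinRoot.mk_C, eq_intCast, ← zsmul_eq_mul]
        exact Submodule.smul_mem _ _ hx
      | add p q hp hq =>
        intro x hx
        rw [map_add, add_mul]
        exact Submodule.add_mem _ (hp x hx) (hq x hx)
      | monomial k c ih =>
        intro x hx
        rw [pow_succ, ← mul_assoc, map_mul, AdjoinRoot.mk_X, mul_assoc]
        exact ih _ (hθ x hx)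
    let I : Ideal (AdjoinRoot f) :=
      { carrier := L
        add_mem' := fun hx hy ↦ L.add_mem hx hy
        zero_mem' := L.zero_mem
        smul_mem' := fun s x hx ↦ hS s x hx }
    have hle : Ideal.span {AdjoinRoot.root f - (z : AdjoinRoot f), (a : AdjoinRoot f)} ≤ I := by
      rw [Ideal.span_le]
      rintro x (rfl | rfl)
      · have h := root_pow_mul_root_sub_mem_span' hdeg hn hm (j := 0) (by omega)
        rw [pow_zero, one_mul] at h
        exact h
      · obtain ⟨k, rfl⟩ : ∃ k, n = k + 1 := ⟨n - 1, by omega⟩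
        exact Submodule.subset_span ⟨Fin.last k, by simp⟩
    exact fun x hx ↦ hle hx
  · rw [Submodule.span_le]
    rintro _ ⟨j, rfl⟩
    by_cases hj : (j : ℕ) + 1 = n
    · simp only [if_pos hj]
      exact Ideal.subset_span (by simp)
    · simp only [if_neg hj]
      exact Ideal.mul_mem_left _ _ (Ideal.subset_span (by simp))

variable [IsDomain (AdjoinRoot f)]

/-- If `ℤ[X]/(f)` is a domain then `deg f ≠ 0`. [folklore] -/
private theorem natDegree_ne_zero_of_isDomain : f.natDegree ≠ 0 := by
  intro h
  have hf : f.Monic := Fact.out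
  have h1 : f = 1 := Polynomial.eq_one_of_monic_natDegree_zero hf h
  have h2 : (AdjoinRoot.mk f) (1 : ℤ[X]) = 0 := by
    rw [← h1]
    exact AdjoinRoot.mk_self
  rw [map_one] at h2
  exact one_ne_zero h2

/-- **KNIGHT–STASINSKI Prop. 4.2: `θ - z, θ(θ - z), …, θⁿ⁻²(θ - z), a` is a `ℤ`-BASIS of `(θ - z, a)`** (`f` monic
irreducible of degree `n`, `0 ≠ a ∣ f(z)`): it spans (above), and `n` spanning vectors of a free `ℤ`-module of rank
`n` (a nonzero ideal of `ℤ[θ] ≅ ℤⁿ`) are independent. [cite: KnightStasinski2023, §4 Prop. 4.2 with Lemma 3.4,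
pp. 96–97] [cite: EndoIwakiPajitnov2026, §3 Cor. 3.12 («is a ℤ-basis of `(p, θ - b)`»)] -/
theorem exists_basis_span_pair (hdeg : f.natDegree = n) {z a m : ℤ} (ha0 : a ≠ 0) (hm : f.eval z = a * m) :
    ∃ b : Module.Basis (Fin n) ℤ (Ideal.span {AdjoinRoot.root f - (z : AdjoinRoot f), (a : AdjoinRoot f)}),
      ∀ j, (b j : AdjoinRoot f) =
        if (j : ℕ) + 1 = n then (a : AdjoinRoot f)
        else AdjoinRoot.root f ^ (j : ℕ) * (AdjoinRoot.root f - (z : AdjoinRoot f)) := by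
  classical
  have hf : f.Monic := Fact.out
  set 𝔞 : Ideal (AdjoinRoot f) := Ideal.span {AdjoinRoot.root f - (z : AdjoinRoot f), (a : AdjoinRoot f)} with h𝔞
  have ha𝔞 : (a : AdjoinRoot f) ∈ 𝔞 := Ideal.subset_span (by simp)
  have h𝔞0 : 𝔞 ≠ ⊥ := fun h ↦ by
    have h1 : (a : AdjoinRoot f) = 0 := (Submodule.mem_bot (R := AdjoinRoot f)).1 (h ▸ ha𝔞)
    have h2 := QuotModule.algebraMap_int_ne_zero (f := f) hdeg (hdeg ▸ natDegree_ne_zero_of_isDomain) ha0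
    rw [eq_intCast] at h2
    exact h2 h1
  -- the family, with values in `𝔞`
  have hmem : ∀ j : Fin n, (if (j : ℕ) + 1 = n then (a : AdjoinRoot f)
      else AdjoinRoot.root f ^ (j : ℕ) * (AdjoinRoot.root f - (z : AdjoinRoot f))) ∈ 𝔞 := fun j ↦ by
    by_cases hj : (j : ℕ) + 1 = n
    · rw [if_pos hj]; exact ha𝔞
    · rw [if_neg hj]; exact Ideal.mul_mem_left _ _ (Ideal.subset_span (by simp))
  let β : Fin n → 𝔞 := fun j ↦ ⟨_, hmem j⟩
  -- rank of `𝔞` over `ℤ` is `n`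
  let bS : Module.Basis (Fin n) ℤ (AdjoinRoot f) := (AdjoinRoot.powerBasis' hf).basis.reindex (finCongr hdeg)
  have hrank : Module.finrank ℤ 𝔞 = n := by
    rw [Module.finrank_eq_card_basis (Ideal.selfBasis bS 𝔞 h𝔞0), Fintype.card_fin]
  -- the family spans `𝔞`
  let ι : 𝔞 →ₗ[ℤ] AdjoinRoot f := 𝔞.subtype.restrictScalars ℤ
  have hι : Function.Injective ι := Subtype.val_injective
  have hspan : ⊤ ≤ Submodule.span ℤ (Set.range β) := by
    intro x _
    have hx : (x : AdjoinRoot f) ∈ Submodule.span ℤ (Set.range fun j : Fin n ↦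
        if (j : ℕ) + 1 = n then (a : AdjoinRoot f)
        else AdjoinRoot.root f ^ (j : ℕ) * (AdjoinRoot.root f - (z : AdjoinRoot f))) := by
      rw [← span_pair_restrictScalars_eq_span hdeg hm]
      exact x.2
    rw [← Submodule.apply_mem_span_image_iff_mem_span hι, ← Set.range_comp]
    exact hx
  refine ⟨basisOfTopLeSpanOfCardEqFinrank β hspan (by rw [Fintype.card_fin, hrank]), fun j ↦ ?_⟩
  rw [coe_basisOfTopLeSpanOfCardEqFinrank]

end Basis

/-! ### §3 KNIGHT–STASINSKI's matrix `C_f(a,z)` (OCHOA's «`A`-matrix») and Theorem 5.2 -/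

section Matrix

/-- **KNIGHT–STASINSKI's matrix `C_f(a,z)`** (OCHOA's «`A`-matrix», REHM's `ₐθ` up to similarity) attached to a monic
`f = xⁿ + k_{n-1}xⁿ⁻¹ + ⋯ + k₀ ∈ ℤ[x]` and integers `a, z` with `a ∣ f(z)`: rows `1, …, n - 2` are the shifted unit
vectors `eᵢ₊₁` («`0 1 0 … 0`», …), row `n - 1` is `(u_{n-1}, u_{n-2}, …, u₁, -f(z)a⁻¹)` with
`uᵢ = -(zⁱ + k_{n-1}zⁱ⁻¹ + ⋯ + k_{n-i})`, and row `n` is `(a, 0, …, 0, z)`.  Here `u_{n-1-j}` is entered as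
`-(f /ₘ (x - z)).coeff j`, the same integer by synthetic division (`f = (x - z)·Σⱼ qⱼxʲ + f(z)` with
`q_{n-1-i} = zⁱ + k_{n-1}zⁱ⁻¹ + ⋯ + k_{n-i}`), and `-f(z)a⁻¹` as `-(f.eval z / a)` (exact when `a ∣ f(z)`); for
`n = 2`, `C_f(a,z) = [[u₁, -f(z)a⁻¹], [a, z]]` «is a general `2 × 2` matrix». It is the transpose of the matrix of
multiplication by `θ` on the `ℤ`-basis `θ - z, θ(θ - z), …, θⁿ⁻²(θ - z), a` of the ideal `(θ - z, a)` (§2, §3).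
[cite: KnightStasinski2023, §1 (the matrix `C_f(a,z)`), p. 88; §5 Lemma 5.1, p. 98] -/
def knightStasinskiMatrix (n : ℕ) (f : ℤ[X]) (a z : ℤ) : _root_.Matrix (Fin n) (Fin n) ℤ :=
  Matrix.of fun i j ↦
    if (i : ℕ) + 1 = n then (if (j : ℕ) + 1 = n then z else if (j : ℕ) = 0 then a else 0)
    else if (i : ℕ) + 2 = n then (if (j : ℕ) + 1 = n then -(f.eval z / a) else -(f /ₘ (X - C z)).coeff j)
    else if (j : ℕ) = i + 1 then 1 else 0

/-- The entries of `C_f(a,z)`. [cite: KnightStasinski2023, §5 Lemma 5.1, p. 98] -/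
theorem knightStasinskiMatrix_apply (n : ℕ) (f : ℤ[X]) (a z : ℤ) (i j : Fin n) :
    knightStasinskiMatrix n f a z i j =
      if (i : ℕ) + 1 = n then (if (j : ℕ) + 1 = n then z else if (j : ℕ) = 0 then a else 0)
      else if (i : ℕ) + 2 = n then (if (j : ℕ) + 1 = n then -(f.eval z / a) else -(f /ₘ (X - C z)).coeff j)
      else if (j : ℕ) = i + 1 then 1 else 0 := rfl

/-- **`n = 2`: «`C_f(a,z) = [[u₁, -f(z)a⁻¹], [a, z]]` is a general `2 × 2` matrix»** (`u₁ = -(z + k₁) =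
-(f /ₘ (x - z))₀`). [cite: KnightStasinski2023, §1, p. 88] -/
theorem knightStasinskiMatrix_two (f : ℤ[X]) (a z : ℤ) :
    knightStasinskiMatrix 2 f a z = !![-(f /ₘ (X - C z)).coeff 0, -(f.eval z / a); a, z] := by
  ext i j
  fin_cases i <;> fin_cases j <;> rfl

variable {f : ℤ[X]} [Fact f.Monic]

/-- `(θ - z)·q(θ) = -f(z)` for `q = f /ₘ (x - z)`, and `q = xⁿ⁻¹ + Σ_{j<n-1} qⱼ xʲ`:
`θⁿ⁻¹(θ - z) = -Σ_{j<n-1} qⱼ θʲ(θ - z) - f(z)`. [folklore] -/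
private theorem root_pow_mul_root_sub_eq (hdeg : f.natDegree = n) (hn : n ≠ 0) (z : ℤ) :
    AdjoinRoot.root f ^ (n - 1) * (AdjoinRoot.root f - (z : AdjoinRoot f)) =
      -(∑ j ∈ Finset.range (n - 1), (((f /ₘ (X - C z)).coeff j : ℤ) : AdjoinRoot f) *
          (AdjoinRoot.root f ^ j * (AdjoinRoot.root f - (z : AdjoinRoot f)))) - ((f.eval z : ℤ) : AdjoinRoot f) := by
  have hf : f.Monic := Fact.out
  set q := f /ₘ (X - C z) with hq
  have hqdeg : q.natDegree = n - 1 := by rw [hq, natDegree_divByMonic f (monic_X_sub_C z), natDegree_X_sub_C, hdeg]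
  have hqlead : q.coeff (n - 1) = 1 := by
    rw [← hqdeg, ← leadingCoeff, hq, leadingCoeff_divByMonic_of_monic (monic_X_sub_C z), hf.leadingCoeff]
    rw [degree_X_sub_C, degree_eq_natDegree hf.ne_zero, hdeg]
    exact_mod_cast Nat.one_le_iff_ne_zero.2 hn
  -- `q(θ) = Σ_{j<n-1} qⱼ θʲ + θⁿ⁻¹`
  have hqθ : aeval (AdjoinRoot.root f) q = ∑ j ∈ Finset.range (n - 1), ((q.coeff j : ℤ) : AdjoinRoot f) *
      AdjoinRoot.root f ^ j + AdjoinRoot.root f ^ (n - 1) := by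
    conv_lhs => rw [q.as_sum_range' n (by omega)]
    rw [map_sum, show n = (n - 1) + 1 by omega, Finset.sum_range_succ, Nat.add_sub_cancel, aeval_monomial, hqlead]
    simp only [aeval_monomial, eq_intCast, Int.cast_one, one_mul]
  -- `f(z) + (θ - z) q(θ) = f(θ) = 0`
  have hdiv : ((f.eval z : ℤ) : AdjoinRoot f) + (AdjoinRoot.root f - (z : AdjoinRoot f)) *
      aeval (AdjoinRoot.root f) q = 0 := by
    have h := congrArg (aeval (AdjoinRoot.root f)) (modByMonic_add_div f (X - C z))
    rwa [modByMonic_X_sub_C_eq_C_eval, map_add, map_mul, aeval_C, map_sub, aeval_X, aeval_C, eq_intCast, eq_intCast,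
      AdjoinRoot.aeval_eq f, AdjoinRoot.mk_self, ← hq] at h
  rw [hqθ, mul_add, Finset.mul_sum] at hdiv
  have h3 : ∑ j ∈ Finset.range (n - 1), (((q.coeff j : ℤ) : AdjoinRoot f)) *
      (AdjoinRoot.root f ^ j * (AdjoinRoot.root f - (z : AdjoinRoot f))) =
      ∑ j ∈ Finset.range (n - 1), (AdjoinRoot.root f - (z : AdjoinRoot f)) *
        ((((q.coeff j : ℤ) : AdjoinRoot f)) * AdjoinRoot.root f ^ j) :=
    Finset.sum_congr rfl fun j _ ↦ by ring
  rw [h3]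
  linear_combination hdiv

/-- **The column relations `θ·βⱼ = Σᵢ C_f(a,z)ⱼᵢ βᵢ`** for the family `β = (θ - z, θ(θ - z), …, θⁿ⁻²(θ - z), a)`:
`C_f(a,z)ᵀ` is the matrix of multiplication by `θ` on `β`. [cite: KnightStasinski2023, §5 Lemma 5.1 and proof
of Thm. 5.2, pp. 98–99] -/
theorem root_mul_eq_sum_knightStasinskiMatrix (hdeg : f.natDegree = n) (hn : 2 ≤ n) {z a m : ℤ} (ha0 : a ≠ 0)
    (hm : f.eval z = a * m) (j : Fin n) :
    AdjoinRoot.root f * (if (j : ℕ) + 1 = n then (a : AdjoinRoot f)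
        else AdjoinRoot.root f ^ (j : ℕ) * (AdjoinRoot.root f - (z : AdjoinRoot f))) =
      ∑ i : Fin n, ((knightStasinskiMatrix n f a z j i : ℤ) : AdjoinRoot f) *
        (if (i : ℕ) + 1 = n then (a : AdjoinRoot f)
          else AdjoinRoot.root f ^ (i : ℕ) * (AdjoinRoot.root f - (z : AdjoinRoot f))) := by
  obtain ⟨k, rfl⟩ : ∃ k, n = k + 2 := ⟨n - 2, by omega⟩
  simp only [knightStasinskiMatrix_apply]
  by_cases hj : (j : ℕ) + 1 = k + 2
  · -- last row `(a, 0, …, 0, z)`: `θ a = a(θ - z) + z a`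
    simp only [if_pos hj]
    rw [Fintype.sum_eq_add (Fin.last (k + 1)) (0 : Fin (k + 2)) (by
        intro h; have := congrArg Fin.val h; simp at this)]
    · simp [Fin.val_last]
      ring
    · rintro i ⟨hi1, hi2⟩
      have hi1' : ¬ ((i : ℕ) + 1 = k + 2) := fun h ↦ hi1 (Fin.ext (by simp [Fin.val_last]; omega))
      have hi2' : ¬ ((i : ℕ) = 0) := fun h ↦ hi2 (Fin.ext (by simpa using h))
      rw [if_neg hi1', if_neg hi2', Int.cast_zero, zero_mul]
  by_cases hj2 : (j : ℕ) + 2 = k + 2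
  · -- row `n - 1`: `θ · θⁿ⁻²(θ - z) = -Σ qᵢ θⁱ(θ - z) - m a`
    simp only [if_neg hj, if_pos hj2]
    have hjk : (j : ℕ) = k := by omega
    rw [Fin.sum_univ_castSucc]
    simp only [Fin.val_castSucc, Fin.val_last, if_true]
    have hcast : ∀ i : Fin (k + 1), ¬ ((i : ℕ) + 1 = k + 2) := fun i h ↦ by omega
    simp only [hcast, if_false]
    have hrow := root_pow_mul_root_sub_eq hdeg (by omega) z
    simp only [show k + 2 - 1 = k + 1 by omega, Finset.sum_range, hm, Int.cast_mul] at hrow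
    rw [hm, Int.mul_ediv_cancel_left _ ha0, hjk, ← mul_assoc, ← pow_succ', hrow]
    simp only [Int.cast_neg, neg_mul, Finset.sum_neg_distrib]
    ring
  · -- rows `1, …, n - 2`: `θ · θʲ(θ - z) = θʲ⁺¹(θ - z)`
    simp only [if_neg hj, if_neg hj2]
    have hj' : (j : ℕ) + 1 < k + 2 := by omega
    rw [Finset.sum_eq_single (⟨(j : ℕ) + 1, hj'⟩ : Fin (k + 2))]
    · rw [if_pos rfl, if_neg (by dsimp only; omega), Int.cast_one, one_mul, ← mul_assoc, ← pow_succ']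
    · intro i _ hi
      rw [if_neg (fun h ↦ hi (Fin.ext h)), Int.cast_zero, zero_mul]
    · exact fun h ↦ absurd (Finset.mem_univ _) h

variable [IsDomain (AdjoinRoot f)]

/-- The coordinate isomorphism `ℤⁿ ≅ (θ - z, a)` of the basis of §2 carries `C_f(a,z)ᵀ` to multiplication by `θ`.
[folklore] -/
private theorem exists_linearEquiv_span_pair (hdeg : f.natDegree = n) (hn : 2 ≤ n) {z a m : ℤ} (ha0 : a ≠ 0)
    (hm : f.eval z = a * m) :
    ∃ g : (Fin n → ℤ) ≃ₗ[ℤ] Ideal.span {AdjoinRoot.root f - (z : AdjoinRoot f), (a : AdjoinRoot f)},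
      ∀ v, g ((knightStasinskiMatrix n f a z)ᵀ *ᵥ v) = AdjoinRoot.root f • g v := by
  obtain ⟨b, hb⟩ := exists_basis_span_pair hdeg ha0 hm
  have hrel : ∀ j, AdjoinRoot.root f • b j = ∑ i, (knightStasinskiMatrix n f a z j i : ℤ) • b i := fun j ↦ by
    apply Subtype.ext
    rw [Submodule.coe_smul, Submodule.coe_sum, smul_eq_mul, hb j, root_mul_eq_sum_knightStasinskiMatrix hdeg hn ha0 hm j]
    refine Finset.sum_congr rfl fun i _ ↦ ?_
    rw [Submodule.coe_smul_of_tower, hb i, zsmul_eq_mul]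
  refine ⟨b.equivFun.symm, fun v ↦ ?_⟩
  simp only [Module.Basis.equivFun_symm_apply, Finset.smul_sum]
  conv_rhs => arg 2; ext x; rw [smul_comm, hrel, Finset.smul_sum]
  rw [Finset.sum_comm]
  refine Finset.sum_congr rfl fun i _ ↦ ?_
  rw [Matrix.mulVec, dotProduct, Finset.sum_smul]
  refine Finset.sum_congr rfl fun j _ ↦ ?_
  rw [Matrix.transpose_apply, smul_smul, mul_comm]

omit [Fact f.Monic] [IsDomain (AdjoinRoot f)] in
/-- A `ℤ`-linear injection `g : ℤⁿ → N` into a `ℤ[θ]`-module with `g(A v) = θ · g(v)` forces `f(A) = 0`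
(`g(f(A)v) = f(θ)·g(v) = 0`). [folklore] -/
private theorem aeval_eq_zero_of_linearEquiv {A : _root_.Matrix (Fin n) (Fin n) ℤ} {N : Type*} [AddCommGroup N]
    [Module (AdjoinRoot f) N] (g : (Fin n → ℤ) ≃ₗ[ℤ] N) (hg : ∀ v, g (A *ᵥ v) = AdjoinRoot.root f • g v) :
    aeval A f = 0 := by
  refine Matrix.toLin'.injective (LinearMap.ext fun v ↦ ?_)
  rw [Matrix.toLin'_apply, map_zero, LinearMap.zero_apply]
  apply g.injective
  rw [map_zero]
  have h := QuotModule.map_aeval_mulVec g.toLinearMap.toAddMonoidHom hg f v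
  rw [AdjoinRoot.mk_self, zero_smul] at h
  exact h

omit [Fact f.Monic] [IsDomain (AdjoinRoot f)] in
/-- A `ℤ`-linear isomorphism `g : ℤⁿ ≅ N` with `g(A v) = θ · g(v)` is a `ℤ[θ]`-isomorphism `ℤⁿ_A ≅ N`. [folklore] -/
private theorem nonempty_linearEquiv_of_linearEquiv' {A : _root_.Matrix (Fin n) (Fin n) ℤ} {hA : aeval A f = 0}
    {N : Type*} [AddCommGroup N] [Module (AdjoinRoot f) N] (g : (Fin n → ℤ) ≃ₗ[ℤ] N)
    (hg : ∀ v, g (A *ᵥ v) = AdjoinRoot.root f • g v) : Nonempty (QuotModule f A hA ≃ₗ[AdjoinRoot f] N) := by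
  let T : QuotModule f A hA →ₗ[AdjoinRoot f] N := QuotModule.lift g.toLinearMap.toAddMonoidHom hg
  have hT : ∀ v, T (QuotModule.of f A hA v) = g v := fun v ↦ QuotModule.lift_of _ _ v
  refine ⟨LinearEquiv.ofBijective T ⟨fun x y hxy ↦ ?_, fun s ↦ ?_⟩⟩
  · obtain ⟨v, rfl⟩ := (QuotModule.of f A hA).surjective x
    obtain ⟨w, rfl⟩ := (QuotModule.of f A hA).surjective y
    rw [hT, hT] at hxy
    rw [g.injective hxy]
  · exact ⟨QuotModule.of f A hA (g.symm s), by rw [hT, LinearEquiv.apply_symm_apply]⟩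

/-- **`f(C_f(a,z)ᵀ) = 0`**: for `f` monic irreducible of degree `n ≥ 2` and `0 ≠ a ∣ f(z)`, the transpose of
`C_f(a,z)` is a matrix root of `f` (it is the matrix of `θ` on a `ℤ`-basis of `(θ - z, a)`).
[cite: KnightStasinski2023, §5 Lemma 5.1 and Thm. 5.2, pp. 98–99] -/
theorem aeval_transpose_knightStasinskiMatrix_eq_zero (hdeg : f.natDegree = n) (hn : 2 ≤ n) {z a m : ℤ}
    (ha0 : a ≠ 0) (hm : f.eval z = a * m) : aeval (knightStasinskiMatrix n f a z)ᵀ f = 0 := by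
  obtain ⟨g, hg⟩ := exists_linearEquiv_span_pair hdeg hn ha0 hm
  exact aeval_eq_zero_of_linearEquiv g hg

/-- **`f(C_f(a,z)) = 0`**. [cite: KnightStasinski2023, §5 Lemma 5.1 and Thm. 5.2, pp. 98–99] -/
theorem aeval_knightStasinskiMatrix_eq_zero (hdeg : f.natDegree = n) (hn : 2 ≤ n) {z a m : ℤ}
    (ha0 : a ≠ 0) (hm : f.eval z = a * m) : aeval (knightStasinskiMatrix n f a z) f = 0 :=
  (aeval_transpose_eq_zero_iff _).1 (aeval_transpose_knightStasinskiMatrix_eq_zero hdeg hn ha0 hm)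

/-- **The characteristic polynomial of `C_f(a,z)` is `f`** (`f` monic irreducible, `0 ≠ a ∣ f(z)`; from `f(C) = 0` by
the tree's `aeval_eq_zero_iff_charpoly_eq`) — so `C_f(a,z)` lies in the matrix side of the correspondence.
[cite: KnightStasinski2023, §1, p. 88 («every similarity class with characteristic polynomial `f(x)` …»); §5 Thm. 5.2, p. 99] -/
theorem charpoly_knightStasinskiMatrix (hdeg : f.natDegree = n) (hn : 2 ≤ n) {z a m : ℤ}
    (ha0 : a ≠ 0) (hm : f.eval z = a * m) : (knightStasinskiMatrix n f a z).charpoly = f :=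
  (aeval_eq_zero_iff_charpoly_eq hdeg (by omega) _).1 (aeval_knightStasinskiMatrix_eq_zero hdeg hn ha0 hm)

namespace QuotModule

/-- **KNIGHT–STASINSKI, Thm. 5.2 (first part): «The similarity class in `Mₙ(ℤ)` that corresponds to the ideal class
of an ideal `𝔞 = (θ - z, a)` of degree one under the Latimer–MacDuffee correspondence contains a matrix of the form
`C_f(a,z)`»** — in the tree's conventions (`Φ [A] = [J]` iff `ℤⁿ_A ≅ J` with `θ` acting on columns; the printed
eigenvector convention is `Φ [Aᵀ]`, see `LatimerMacDuffeeCompanion`): `ℤⁿ_{C_f(a,z)ᵀ} ≅ (θ - z, a)` as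
`ℤ[θ]`-modules, for `f` monic irreducible of degree `n ≥ 2` and `0 ≠ a ∣ f(z)` (the coordinate isomorphism of the
`ℤ`-basis `θ - z, …, θⁿ⁻²(θ - z), a` of §2). [cite: KnightStasinski2023, §5 Thm. 5.2 with Lemma 5.1, Prop. 4.2 and
Lemma 3.5, pp. 96–99] -/
theorem nonempty_linearEquiv_transpose_knightStasinskiMatrix (hdeg : f.natDegree = n) (hn : 2 ≤ n) {z a m : ℤ}
    (ha0 : a ≠ 0) (hm : f.eval z = a * m) (hX : aeval (knightStasinskiMatrix n f a z)ᵀ f = 0) :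
    Nonempty (QuotModule f (knightStasinskiMatrix n f a z)ᵀ hX ≃ₗ[AdjoinRoot f]
      Ideal.span {AdjoinRoot.root f - (z : AdjoinRoot f), (a : AdjoinRoot f)}) := by
  obtain ⟨g, hg⟩ := exists_linearEquiv_span_pair hdeg hn ha0 hm
  exact nonempty_linearEquiv_of_linearEquiv' g hg

/-- **`ℤⁿ_{C_f(a,z)} ≅ ((a) : (θ - z, a))`, the dual («complementary») class** — by TAUSSKY's transposition theorem
(`LatimerMacDuffeeTranspose`) applied to §3. [cite: KnightStasinski2023, §5 Thm. 5.2, p. 99] [cite: Taussky1974,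
§1, p. 64] -/
theorem nonempty_linearEquiv_knightStasinskiMatrix_colon (hdeg : f.natDegree = n) (hn : 2 ≤ n) {z a m : ℤ}
    (ha0 : a ≠ 0) (hm : f.eval z = a * m) (hX : aeval (knightStasinskiMatrix n f a z) f = 0) :
    Nonempty (QuotModule f (knightStasinskiMatrix n f a z) hX ≃ₗ[AdjoinRoot f]
      (Ideal.span {(a : AdjoinRoot f)}).colon
        (Ideal.span {AdjoinRoot.root f - (z : AdjoinRoot f), (a : AdjoinRoot f)} : Set (AdjoinRoot f))) := by
  have hXt := aeval_transpose_knightStasinskiMatrix_eq_zero hdeg hn ha0 hm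
  have hXtt : aeval (knightStasinskiMatrix n f a z)ᵀᵀ f = 0 := by rwa [Matrix.transpose_transpose]
  obtain ⟨e⟩ := nonempty_linearEquiv_transpose_knightStasinskiMatrix hdeg hn ha0 hm hXt
  have ha : (a : AdjoinRoot f) ∈ Ideal.span {AdjoinRoot.root f - (z : AdjoinRoot f), (a : AdjoinRoot f)} :=
    Ideal.subset_span (by simp)
  have ha0' : (a : AdjoinRoot f) ≠ 0 := by
    have h := algebraMap_int_ne_zero (f := f) hdeg (by omega) ha0
    rwa [eq_intCast] at h
  obtain ⟨e'⟩ := nonempty_linearEquiv_transpose_colon (hAt := hXtt) hdeg e ha ha0'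
  have e0 : QuotModule f (knightStasinskiMatrix n f a z) hX ≃ₗ[AdjoinRoot f]
      QuotModule f (knightStasinskiMatrix n f a z)ᵀᵀ hXtt :=
    linearEquivOfConj (hA := hX) (hB := hXtt) 1 (by rw [Matrix.det_one]; exact isUnit_one)
      (by rw [one_mul, Matrix.transpose_transpose, mul_one])
  exact ⟨e0.trans e'⟩

end QuotModule

/-- **`Φ [C_f(a,z)ᵀ] = [(θ - z, a)]`** for every class map `Φ` with `Φ [A] = [J]` whenever `ℤⁿ_A ≅ J` (in particular the
bijection of `exists_equiv_quot_conj_quot_idealClass`). [cite: KnightStasinski2023, §5 Thm. 5.2, p. 99] -/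
theorem apply_transpose_knightStasinskiMatrix_eq (hdeg : f.natDegree = n) (hn : 2 ≤ n) {z a m : ℤ}
    (ha0 : a ≠ 0) (hm : f.eval z = a * m) (hX : aeval (knightStasinskiMatrix n f a z)ᵀ f = 0) {β : Type*}
    {Φ : Quot (fun A B : {A : _root_.Matrix (Fin n) (Fin n) ℤ // aeval A f = 0} ↦
        ∃ P : _root_.Matrix (Fin n) (Fin n) ℤ, IsUnit P.det ∧ P * A.1 = B.1 * P) → β}
    {Ψ : {J : Ideal (AdjoinRoot f) // J ≠ ⊥} → β}
    (hΦ : ∀ (A : _root_.Matrix (Fin n) (Fin n) ℤ) (hA : aeval A f = 0) (J : Ideal (AdjoinRoot f)) (hJ : J ≠ ⊥),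
      Nonempty (QuotModule f A hA ≃ₗ[AdjoinRoot f] J) → Φ (Quot.mk _ ⟨A, hA⟩) = Ψ ⟨J, hJ⟩)
    (h𝔞 : Ideal.span {AdjoinRoot.root f - (z : AdjoinRoot f), (a : AdjoinRoot f)} ≠ ⊥) :
    Φ (Quot.mk _ ⟨(knightStasinskiMatrix n f a z)ᵀ, hX⟩) =
      Ψ ⟨Ideal.span {AdjoinRoot.root f - (z : AdjoinRoot f), (a : AdjoinRoot f)}, h𝔞⟩ :=
  hΦ _ hX _ h𝔞 (QuotModule.nonempty_linearEquiv_transpose_knightStasinskiMatrix hdeg hn ha0 hm hX)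

/-- **KNIGHT–STASINSKI, Thm. 5.2: every similarity class whose ideal class contains an ideal of degree one contains
(the transpose of) a matrix `C_f(a,z)` with `a ∣ f(z)`** — for `f` monic irreducible of degree `n ≥ 2`: if
`ℤⁿ_A ≅ J` and `(x)J = (y)𝔞` (`x, y ≠ 0`) for an ideal `𝔞 ≠ 0` with `ℤ → ℤ[θ]/𝔞` onto, then `𝔞 = (θ - z, a)` with
`0 ≠ a ∣ f(z)` and `A ∼ C_f(a,z)ᵀ` over `GLₙ(ℤ)`. («In particular, if `ℤ[θ]` is the maximal order, then every
similarity class contains a matrix of this form» rests on LENSTRA's theorem, Cor. 2.8, not formalised here.)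
[cite: KnightStasinski2023, §5 Thm. 5.2, p. 99; §2 Lemma 2.3, p. 91] -/
theorem exists_conj_transpose_knightStasinskiMatrix (hdeg : f.natDegree = n) (hn : 2 ≤ n)
    {A : _root_.Matrix (Fin n) (Fin n) ℤ} {hA : aeval A f = 0} {J 𝔞 : Ideal (AdjoinRoot f)}
    (e : QuotModule f A hA ≃ₗ[AdjoinRoot f] J) (h𝔞 : Function.Surjective (algebraMap ℤ (AdjoinRoot f ⧸ 𝔞)))
    (h𝔞0 : 𝔞 ≠ ⊥) {x y : AdjoinRoot f} (hx : x ≠ 0) (hy : y ≠ 0) (hJ𝔞 : Ideal.span {x} * J = Ideal.span {y} * 𝔞) :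
    ∃ z a m : ℤ, a ≠ 0 ∧ f.eval z = a * m ∧
      𝔞 = Ideal.span {AdjoinRoot.root f - (z : AdjoinRoot f), (a : AdjoinRoot f)} ∧
      ∃ P : _root_.Matrix (Fin n) (Fin n) ℤ, IsUnit P.det ∧ P * A = (knightStasinskiMatrix n f a z)ᵀ * P := by
  have hf : f.Monic := Fact.out
  obtain ⟨z, a, hz, ha, h𝔞eq⟩ := exists_eq_span_pair_of_surjective h𝔞
  obtain ⟨m, hm⟩ := dvd_eval_of_root_sub_mem hz ha
  -- `a ≠ 0`: a nonzero ideal of the order `ℤ[θ]` meets `ℤ` non-trivially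
  have ha0 : a ≠ 0 := by
    rintro rfl
    obtain ⟨s, hs𝔞, hs0⟩ := Submodule.exists_mem_ne_zero_of_ne_bot h𝔞0
    haveI : Module.Finite ℤ (AdjoinRoot f) := hf.finite_adjoinRoot
    have h := Ideal.comap_ne_bot_of_integral_mem hs0 hs𝔞 (Algebra.IsIntegral.isIntegral (R := ℤ) s)
    rw [ha] at h
    exact h (Ideal.span_singleton_eq_bot.2 rfl)
  have hX := aeval_transpose_knightStasinskiMatrix_eq_zero hdeg hn ha0 hm
  obtain ⟨e𝔞⟩ := QuotModule.nonempty_linearEquiv_transpose_knightStasinskiMatrix hdeg hn ha0 hm hX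
  refine ⟨z, a, m, ha0, hm, h𝔞eq, ?_⟩
  subst h𝔞eq
  exact exists_isUnit_det_and_mul_eq_mul_of_linearEquiv e e𝔞 hx hy hJ𝔞

end Matrix

/-! ### §4 KNIGHT–STASINSKI Lemma 2.2, the isomorphism `ℤ/(a) ≅ ℤ[θ]/(θ - z, a)`; similarity of the `C_f(a,z)` -/

section Quotient

variable {f : ℤ[X]}

/-- **`ℤ ∩ (θ - z, a) = aℤ` when `a ∣ f(z)`**: the ring map `ℤ[θ] → ℤ/(a)`, `θ ↦ z` (well defined because
`f(z) ≡ 0 (mod a)`) kills `(θ - z, a)` and is the reduction on `ℤ`. (For `a ∤ f(z)` the contraction is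
`gcd(a, f(z))ℤ` instead.) [cite: KnightStasinski2023, §2 Lemma 2.2 («`𝔟 = A ∩ (θ - z, 𝔟)`») and §4 Prop. 4.2, pp. 90, 97] -/
theorem comap_span_pair_eq_span {z a m : ℤ} (hm : f.eval z = a * m) :
    (Ideal.span {AdjoinRoot.root f - (z : AdjoinRoot f), (a : AdjoinRoot f)}).comap (algebraMap ℤ (AdjoinRoot f)) =
      Ideal.span {a} := by
  apply le_antisymm
  · intro c hc
    rw [Ideal.mem_comap, eq_intCast] at hc
    -- `φ : ℤ[θ] → ℤ/(a)`, `θ ↦ z`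
    let φ : AdjoinRoot f →+* ℤ ⧸ Ideal.span {a} :=
      AdjoinRoot.lift (Ideal.Quotient.mk (Ideal.span {a})) (Ideal.Quotient.mk (Ideal.span {a}) z) (by
        rw [eval₂_at_apply, hm, Ideal.Quotient.eq_zero_iff_mem]
        exact Ideal.mul_mem_right _ _ (Ideal.mem_span_singleton_self a))
    have hφ : Ideal.span {AdjoinRoot.root f - (z : AdjoinRoot f), (a : AdjoinRoot f)} ≤ RingHom.ker φ := by
      rw [Ideal.span_le]
      rintro x (rfl | rfl)
      · rw [SetLike.mem_coe, RingHom.mem_ker, map_sub, AdjoinRoot.lift_root, map_intCast, ← map_intCast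
          (Ideal.Quotient.mk (Ideal.span {a})), Int.cast_id, sub_self]
      · rw [SetLike.mem_coe, RingHom.mem_ker, map_intCast, ← map_intCast (Ideal.Quotient.mk (Ideal.span {a})),
          Ideal.Quotient.eq_zero_iff_mem, Int.cast_id]
        exact Ideal.mem_span_singleton_self a
    have h := hφ hc
    rwa [RingHom.mem_ker, map_intCast, ← map_intCast (Ideal.Quotient.mk (Ideal.span {a})), Int.cast_id,
      Ideal.Quotient.eq_zero_iff_mem] at h
  · rw [Ideal.span_le, Set.singleton_subset_iff, SetLike.mem_coe, Ideal.mem_comap, eq_intCast]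
    exact Ideal.subset_span (by simp)

/-- **`(θ - z, a)` is of degree one**: `ℤ → ℤ[θ]/(θ - z, a)` is onto (it contains `θ - z`; any `a`, `z`).
[cite: KnightStasinski2023, §2 Lemma 2.3, p. 91] -/
theorem surjective_algebraMap_quotient_span_pair (z a : ℤ) :
    Function.Surjective (algebraMap ℤ
      (AdjoinRoot f ⧸ Ideal.span {AdjoinRoot.root f - (z : AdjoinRoot f), (a : AdjoinRoot f)})) :=
  (surjective_algebraMap_quotient_iff_exists_root_sub_mem _).2 ⟨z, Ideal.subset_span (by simp)⟩

/-- **KNIGHT–STASINSKI, Lemma 2.2: `ℤ/(a) ≅ ℤ[θ]/(θ - z, a)`** (induced by `ℤ ⊂ ℤ[θ]`), when `a ∣ f(z)` — «the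
embedding `A → A[θ]` induces an isomorphism `A/𝔟 → A[θ]/(θ - z, 𝔟)`»; injective by `ℤ ∩ (θ - z, a) = (a)`, onto
because `(θ - z, a)` is of degree one. [cite: KnightStasinski2023, §2 Lemma 2.2, p. 90] -/
theorem nonempty_quotient_span_ringEquiv_quotient_span_pair {z a m : ℤ} (hm : f.eval z = a * m) :
    Nonempty ((ℤ ⧸ Ideal.span {a}) ≃+*
      (AdjoinRoot f ⧸ Ideal.span {AdjoinRoot.root f - (z : AdjoinRoot f), (a : AdjoinRoot f)})) := by
  have hle : Ideal.span {a} ≤ (Ideal.span {AdjoinRoot.root f - (z : AdjoinRoot f), (a : AdjoinRoot f)}).comap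
      (algebraMap ℤ (AdjoinRoot f)) := (comap_span_pair_eq_span hm).ge
  refine ⟨RingEquiv.ofBijective (Ideal.quotientMap _ (algebraMap ℤ (AdjoinRoot f)) hle) ⟨?_, ?_⟩⟩
  · exact Ideal.quotientMap_injective' (comap_span_pair_eq_span hm).le
  · intro x
    obtain ⟨c, hc⟩ := surjective_algebraMap_quotient_span_pair (f := f) z a x
    refine ⟨Ideal.Quotient.mk _ c, ?_⟩
    rw [Ideal.quotientMap_mk, ← hc, IsScalarTower.algebraMap_apply ℤ (AdjoinRoot f) (AdjoinRoot f ⧸ _),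
      Ideal.Quotient.algebraMap_eq]

/-- **The index of `(θ - z, a)` in `ℤ[θ]` is `|a|`** (`a ∣ f(z)`; `Nat.card`, so `0` for `a = 0`).
[cite: KnightStasinski2023, §2 Lemma 2.2, p. 90; §4 Prop. 4.2 (the ideal matrix `κ(a,z)` has determinant `a`), p. 97] -/
theorem natCard_quotient_span_pair {z a m : ℤ} (hm : f.eval z = a * m) :
    Nat.card (AdjoinRoot f ⧸ Ideal.span {AdjoinRoot.root f - (z : AdjoinRoot f), (a : AdjoinRoot f)}) = a.natAbs := by
  obtain ⟨e⟩ := nonempty_quotient_span_ringEquiv_quotient_span_pair (f := f) hm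
  rw [← Nat.card_congr e.toEquiv, Nat.card_congr (Int.quotientSpanEquivZMod a).toEquiv, Nat.card_zmod]

variable [Fact f.Monic] [IsDomain (AdjoinRoot f)]

/-- **Two matrices `C_f(a,z)ᵀ`, `C_f(a′,z′)ᵀ` are `GLₙ(ℤ)`-conjugate iff `(θ - z, a)` and `(θ - z′, a′)` lie in the same
ideal class** (`(x)(θ - z, a) = (y)(θ - z′, a′)` for some `x, y ≠ 0`), and iff `C_f(a,z) ∼ C_f(a′,z′)` — the
injectivity half of the correspondence on these representatives (TAUSSKY's Theorems 2–3).
[cite: KnightStasinski2023, §3 Thm. 3.2 and §5 Thm. 5.2, pp. 94, 99] [cite: Taussky1949, Theorems 2–3] -/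
theorem exists_conj_knightStasinskiMatrix_iff (hdeg : f.natDegree = n) (hn : 2 ≤ n) {z a m z' a' m' : ℤ}
    (ha0 : a ≠ 0) (hm : f.eval z = a * m) (ha0' : a' ≠ 0) (hm' : f.eval z' = a' * m') :
    (∃ P : _root_.Matrix (Fin n) (Fin n) ℤ, IsUnit P.det ∧
        P * knightStasinskiMatrix n f a z = knightStasinskiMatrix n f a' z' * P) ↔
      ∃ x y : AdjoinRoot f, x ≠ 0 ∧ y ≠ 0 ∧
        Ideal.span {x} * Ideal.span {AdjoinRoot.root f - (z : AdjoinRoot f), (a : AdjoinRoot f)} =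
          Ideal.span {y} * Ideal.span {AdjoinRoot.root f - (z' : AdjoinRoot f), (a' : AdjoinRoot f)} := by
  have hX := aeval_transpose_knightStasinskiMatrix_eq_zero hdeg hn ha0 hm
  have hX' := aeval_transpose_knightStasinskiMatrix_eq_zero hdeg hn ha0' hm'
  obtain ⟨e⟩ := QuotModule.nonempty_linearEquiv_transpose_knightStasinskiMatrix hdeg hn ha0 hm hX
  obtain ⟨e'⟩ := QuotModule.nonempty_linearEquiv_transpose_knightStasinskiMatrix hdeg hn ha0' hm' hX'
  have h𝔞 : Ideal.span {AdjoinRoot.root f - (z : AdjoinRoot f), (a : AdjoinRoot f)} ≠ ⊥ := fun h ↦ by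
    have h1 : (a : AdjoinRoot f) ∈ Ideal.span {AdjoinRoot.root f - (z : AdjoinRoot f), (a : AdjoinRoot f)} :=
      Ideal.subset_span (by simp)
    rw [h, Ideal.mem_bot] at h1
    have h2 := QuotModule.algebraMap_int_ne_zero (f := f) hdeg (by omega) ha0
    rw [eq_intCast] at h2
    exact h2 h1
  rw [← exists_conj_transpose_iff]
  exact ⟨fun ⟨P, hP, h⟩ ↦ exists_span_singleton_mul_eq_of_mul_eq_mul h𝔞 e e' hP h,
    fun ⟨x, y, hx, hy, h⟩ ↦ exists_isUnit_det_and_mul_eq_mul_of_linearEquiv e e' hx hy h⟩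

end Quotient

end Literature.LinearAlgebra.Matrix
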